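import Summits.CriticalPhenomena.PercolationContinuityZ3.Theorems.PercNearOneGluingNoHeavyLowerTailTwoLevelLonelyRelayTools
import HarnessLib

/-!
# `NoHeavyLowerTail` (stmt-CriticalPhenomena-4575) — two-level lonely relay theorem, GAIN side

Support file (factory prove seat `prim-ineq-prove-3`, gen 3; `--supports stmt-CriticalPhenomena-4575`).  No
definitions, no named facts.  Step (b) of the two-level lonely relay theorem (`…TwoLevelLonelyRelay.lean`), same
notation as `…TwoLevelLonelyRelayLoss.lean` (the two files are independent; both rest on `…TwoLevelLonelyRelayTools.lean`).
* `class_unique` — a realised block (internally connected, separated from the other relays) is unique;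
* `gain_class` — for a block `W ⊆ A∖u` and `H_W = {u ↮ A∖u} ∩ {W ↮ A∖W} ∩ {W internally connected}`:
  `(Σ_{r ∈ L∩W} φ_r) · μ(H_W) ≤ μ(H_W ∩ {o ↔ W})` — the rider lemma (`TwoLevelLonelyRelay.rider`) followed by
  Kozma–Nitzan Lemma 2 (`TwoLevelLonelyRelay.lemma2_ratio`);
* `gain_ge` — `Σ_{r ≠ u} φ_r · μ({u ↮ A∖u} ∩ {r ↔ far r}) ≤ μ({u ↮ far u} ∩ Λᶜ)`: given `u ↮ A∖u`, a relay
  joined to its far side lies in a realised CROSSING block, on `{o ↔ W}` the captured set is not in `𝓛`, and the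
  realised blocks are pairwise disjoint events.
-/

namespace Summit.CriticalPhenomena.PercolationContinuityZ3.Theorems

open scoped BigOperators Classical Topology
open MeasureTheory Set Filter
open Literature.Probability.LatticeModels (prodBernoulli)
open Literature.Probability.Percolation

variable {n : ℕ}

namespace TwoLevelLonelyRelay

/-- Bookkeeping for the far side: `far r` is the other half, so `r ∈ A`, `far r ⊆ A∖r`, and every `b ∈ far r`
lies on the other side of the bipartition (local copy of `far_facts` of `…Loss.lean`, so that this file depends on the
Tools file only). [folklore] -/
private theorem far_facts_gain (A B L : Finset (Fin n)) (far : Fin n → Finset (Fin n)) (hBA : B ⊆ A)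
    (hL : ∀ r ∈ L, (r ∈ B ∧ far r = A \ B) ∨ (r ∈ A \ B ∧ far r = B)) {r : Fin n} (hr : r ∈ L) :
    r ∈ A ∧ far r ⊆ A.erase r ∧
      ∀ b ∈ far r, (r ∈ B ∧ b ∈ A \ B) ∨ (r ∈ A \ B ∧ b ∈ B) := by
  rcases hL r hr with ⟨hrB, hfar⟩ | ⟨hrB, hfar⟩
  · refine ⟨hBA hrB, fun b hb => ?_, fun b hb => Or.inl ⟨hrB, hfar ▸ hb⟩⟩
    rw [hfar] at hb
    exact Finset.mem_erase.2 ⟨fun h => (Finset.mem_sdiff.1 hb).2 (h ▸ hrB), (Finset.mem_sdiff.1 hb).1⟩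
  · refine ⟨(Finset.mem_sdiff.1 hrB).1, fun b hb => ?_, fun b hb => Or.inr ⟨hrB, hfar ▸ hb⟩⟩
    rw [hfar] at hb
    exact Finset.mem_erase.2 ⟨fun h => (Finset.mem_sdiff.1 hrB).2 (h ▸ hb), hBA hb⟩

/-- Uniqueness of a realised block: two internally connected, externally separated relay blocks that are
joined to each other coincide. [folklore] -/
theorem class_unique (A W W' : Finset (Fin n)) (hW : W ⊆ A) (hW' : W' ⊆ A) (ω : BondConfig (Fin n))
    (hI : ω ∈ {ω : BondConfig (Fin n) | ∀ x ∈ W, ∀ y ∈ A \ W, ω ∉ openConn x y})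
    (hC : ω ∈ {ω : BondConfig (Fin n) | ∀ x ∈ W, ∀ y ∈ W, ω ∈ openConn x y})
    (hI' : ω ∈ {ω : BondConfig (Fin n) | ∀ x ∈ W', ∀ y ∈ A \ W', ω ∉ openConn x y})
    (hC' : ω ∈ {ω : BondConfig (Fin n) | ∀ x ∈ W', ∀ y ∈ W', ω ∈ openConn x y})
    {x x' : Fin n} (hx : x ∈ W) (hx' : x' ∈ W') (hxx' : ω ∈ openConn x x') : W = W' := by
  have h1 : W' ⊆ W := by
    intro y' hy'
    by_contra hyW
    have hr : (openGraph ω).Reachable x y' :=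
      (hxx' : (openGraph ω).Reachable x x').trans (hC' x' hx' y' hy')
    exact hI x hx y' (Finset.mem_sdiff.2 ⟨hW' hy', hyW⟩) hr
  have h2 : W ⊆ W' := by
    intro y hy
    by_contra hyW'
    have hr : (openGraph ω).Reachable x' y :=
      (SimpleGraph.Reachable.symm hxx').trans (hC x hx y hy)
    exact hI' x' hx' y (Finset.mem_sdiff.2 ⟨hW hy, hyW'⟩) hr
  exact Finset.Subset.antisymm h2 h1

/-- **Gain of one realised crossing block** (step (b), one class): for a block `W ⊆ A∖u`, designated
singletons `L`, and `H_W = {u ↮ A∖u} ∩ ({W ↮ A∖W} ∩ {W internally connected})`: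
`(Σ_{r ∈ L ∩ W} φ_r) · μ(H_W) ≤ μ(H_W ∩ {o ↔ W})` — the rider lemma followed by Kozma–Nitzan Lemma 2.
[cite: KozmaNitzan2024, Lemma 2 (p. 6); VandenbergHaggstromKahn2005, Thm. 2.1 at q = 1] -/
theorem gain_class (w : Sym2 (Fin n) → unitInterval) (A W L : Finset (Fin n)) (o u : Fin n)
    (hWA : W ⊆ A.erase u) (huA : u ∈ A)
    (hpos : 0 < (prodBernoulli w).real
      {ω : BondConfig (Fin n) | ∀ x ∈ A, ∀ y ∈ A, x ≠ y → ω ∉ openConn x y}) :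
    (∑ r ∈ L ∩ W, (prodBernoulli w).real ({ω | ∀ y ∈ A.erase r, ω ∉ openConn r y} ∩ openConn o r) /
        (prodBernoulli w).real {ω | ∀ y ∈ A.erase r, ω ∉ openConn r y}) *
      (prodBernoulli w).real ({ω | ∀ y ∈ A.erase u, ω ∉ openConn u y} ∩
        ({ω | ∀ x ∈ W, ∀ y ∈ A \ W, ω ∉ openConn x y} ∩ {ω | ∀ x ∈ W, ∀ y ∈ W, ω ∈ openConn x y})) ≤
    (prodBernoulli w).real ({ω | ∀ y ∈ A.erase u, ω ∉ openConn u y} ∩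
        ({ω | ∀ x ∈ W, ∀ y ∈ A \ W, ω ∉ openConn x y} ∩ {ω | ∀ x ∈ W, ∀ y ∈ W, ω ∈ openConn x y}) ∩
      {ω | ∃ x ∈ W, ω ∈ openConn o x}) := by
  set μ := prodBernoulli w with hμ
  have hWA' : W ⊆ A := hWA.trans (Finset.erase_subset u A)
  have huW : u ∉ W := fun h => Finset.ne_of_mem_erase (hWA h) rfl
  have huAW : u ∈ A \ W := Finset.mem_sdiff.2 ⟨huA, huW⟩
  set Iso : Set (BondConfig (Fin n)) := {ω | ∀ x ∈ W, ∀ y ∈ A \ W, ω ∉ openConn x y} with hIso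
  set IntC : Set (BondConfig (Fin n)) := {ω | ∀ x ∈ W, ∀ y ∈ W, ω ∈ openConn x y} with hIntC
  set ReW : Set (BondConfig (Fin n)) := {ω | ∃ x ∈ W, ω ∈ openConn o x} with hReW
  set Du : Set (BondConfig (Fin n)) := {ω | ∀ y ∈ A.erase u, ω ∉ openConn u y} with hDu
  set P : Finset (Fin n × Fin n) := ({u} : Finset (Fin n)) ×ˢ ((A \ W).erase u) with hPdef
  have hP : ∀ p ∈ P, p.1 ∈ A \ W := by
    intro p hp
    rw [hPdef, Finset.mem_product, Finset.mem_singleton] at hp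
    rw [hp.1]; exact huAW
  have hPS : ∀ ω : BondConfig (Fin n), (∀ p ∈ P, ω ∉ openConn p.1 p.2) ↔
      ∀ y ∈ (A \ W).erase u, ω ∉ openConn u y := by
    intro ω
    constructor
    · intro h y hy
      exact h (u, y) (by rw [hPdef, Finset.mem_product, Finset.mem_singleton]; exact ⟨rfl, hy⟩)
    · intro h p hp
      rw [hPdef, Finset.mem_product, Finset.mem_singleton] at hp
      have h1 := h p.2 hp.2
      rw [← hp.1] at h1
      exact h1
  -- positivity
  have hsep_sub_Iso : {ω : BondConfig (Fin n) | ∀ x ∈ A, ∀ y ∈ A, x ≠ y → ω ∉ openConn x y} ⊆ Iso := by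
    intro ω hω x hx y hy
    exact hω x (hWA' hx) y (Finset.mem_sdiff.1 hy).1 (fun h => (Finset.mem_sdiff.1 hy).2 (h ▸ hx))
  have hIso_pos : 0 < μ.real Iso := lt_of_lt_of_le hpos (measureReal_mono hsep_sub_Iso)
  have hM_pos : 0 < μ.real (Iso ∩ {ω | ∀ u' ∈ L ∩ W, ∀ y ∈ A.erase u', ω ∉ openConn u' y}) := by
    refine lt_of_lt_of_le hpos (measureReal_mono fun ω hω => ⟨hsep_sub_Iso hω, fun u' hu' y hy => ?_⟩)
    exact hω u' (hWA' (Finset.mem_inter.1 hu').2) y (Finset.mem_erase.1 hy).2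
      (fun h => (Finset.mem_erase.1 hy).1 h.symm)
  -- the rider lemma and Lemma 2
  have key1 := rider w W (A \ W) o P hP
  have key2 := lemma2_ratio w A W (L ∩ W) hWA' Finset.inter_subset_right o hM_pos
  -- set identities
  have hH : Iso ∩ (IntC ∩ {ω | ∀ p ∈ P, ω ∉ openConn p.1 p.2}) = Du ∩ (Iso ∩ IntC) := by
    ext ω
    simp only [Set.mem_inter_iff, Set.mem_setOf_eq, hIso, hIntC, hDu]
    constructor
    · rintro ⟨hI, hC, hp⟩
      refine ⟨fun y hy => ?_, hI, hC⟩
      by_cases hyW : y ∈ W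
      · intro h
        exact hI y hyW u huAW (SimpleGraph.Reachable.symm h)
      · exact (hPS ω).1 hp y (Finset.mem_erase.2 ⟨(Finset.mem_erase.1 hy).1,
          Finset.mem_sdiff.2 ⟨(Finset.mem_erase.1 hy).2, hyW⟩⟩)
    · rintro ⟨hD, hI, hC⟩
      refine ⟨hI, hC, (hPS ω).2 fun y hy => hD y ?_⟩
      exact Finset.mem_erase.2 ⟨(Finset.mem_erase.1 hy).1, (Finset.mem_sdiff.1 (Finset.mem_erase.1 hy).2).1⟩
  have hG : Iso ∩ (ReW ∩ (IntC ∩ {ω | ∀ p ∈ P, ω ∉ openConn p.1 p.2})) = Du ∩ (Iso ∩ IntC) ∩ ReW := by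
    rw [Set.inter_left_comm, hH, Set.inter_comm]
  rw [hH, hG] at key1
  -- combine
  refine le_of_mul_le_mul_right ?_ hIso_pos
  calc (∑ r ∈ L ∩ W, μ.real ({ω | ∀ y ∈ A.erase r, ω ∉ openConn r y} ∩ openConn o r) /
          μ.real {ω | ∀ y ∈ A.erase r, ω ∉ openConn r y}) * μ.real (Du ∩ (Iso ∩ IntC)) * μ.real Iso
      = (∑ r ∈ L ∩ W, μ.real ({ω | ∀ y ∈ A.erase r, ω ∉ openConn r y} ∩ openConn o r) /
          μ.real {ω | ∀ y ∈ A.erase r, ω ∉ openConn r y}) * μ.real Iso * μ.real (Du ∩ (Iso ∩ IntC)) := by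
        ring
    _ ≤ μ.real (Iso ∩ ReW) * μ.real (Du ∩ (Iso ∩ IntC)) :=
        mul_le_mul_of_nonneg_right key2 measureReal_nonneg
    _ ≤ μ.real Iso * μ.real (Du ∩ (Iso ∩ IntC) ∩ ReW) := key1
    _ = μ.real (Du ∩ (Iso ∩ IntC) ∩ ReW) * μ.real Iso := mul_comm _ _

/-- **Gain bound** (step (b)): for a designated singleton `u`,
`Σ_{r ≠ u} φ_r · μ({u ↮ A∖u} ∩ {r ↔ far r}) ≤ μ({u ↮ far u} ∩ Λᶜ)`.  Given `u ↮ A∖u`, a relay `r` joined to its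
far side lies in a realised CROSSING block `W` (internally connected, separated from `A∖W`, meeting both halves);
on `{o ↔ W}` the captured set is not in `𝓛`; the rider lemma and Kozma–Nitzan Lemma 2 (`gain_class`) give
`μ(H_W ∩ {o↔W}) ≥ (Σ_{r∈L∩W} φ_r) μ(H_W)`, and the realised blocks are pairwise disjoint events.
[cite: KozmaNitzan2024, Lemmas 1(i), 2 (pp. 5–6) — mechanism] -/
theorem gain_ge (w : Sym2 (Fin n) → unitInterval) (A B L : Finset (Fin n)) (far : Fin n → Finset (Fin n))
    (o u : Fin n) (hBA : B ⊆ A)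
    (hL : ∀ r ∈ L, (r ∈ B ∧ far r = A \ B) ∨ (r ∈ A \ B ∧ far r = B)) (hu : u ∈ L)
    (hpos : 0 < (prodBernoulli w).real
      {ω : BondConfig (Fin n) | ∀ x ∈ A, ∀ y ∈ A, x ≠ y → ω ∉ openConn x y}) :
    ∑ r ∈ L.erase u, (prodBernoulli w).real ({ω | ∀ y ∈ A.erase r, ω ∉ openConn r y} ∩ openConn o r) /
          (prodBernoulli w).real {ω | ∀ y ∈ A.erase r, ω ∉ openConn r y} *
        (prodBernoulli w).real ({ω | ∀ y ∈ A.erase u, ω ∉ openConn u y} ∩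
          {ω | ∃ b ∈ far r, ω ∈ openConn r b}) ≤
      (prodBernoulli w).real ({ω | ∀ b ∈ far u, ω ∉ openConn u b} ∩
        {ω | A.filter (fun a => ω ∈ openConn o a) = B ∨
          A.filter (fun a => ω ∈ openConn o a) = A \ B ∨
          ∃ r ∈ L, A.filter (fun a => ω ∈ openConn o a) = {r}}ᶜ) := by
  set μ := prodBernoulli w with hμ
  set Du : Set (BondConfig (Fin n)) := {ω | ∀ y ∈ A.erase u, ω ∉ openConn u y} with hDu
  set φ : Fin n → ℝ := fun r => μ.real ({ω | ∀ y ∈ A.erase r, ω ∉ openConn r y} ∩ openConn o r) /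
    μ.real {ω | ∀ y ∈ A.erase r, ω ∉ openConn r y} with hφ
  have hφ0 : ∀ r, 0 ≤ φ r := fun r => div_nonneg measureReal_nonneg measureReal_nonneg
  obtain ⟨huA, hfaru, _⟩ := far_facts_gain A B L far hBA hL hu
  set 𝒲 : Finset (Finset (Fin n)) :=
    ((A.erase u).powerset).filter (fun W => (W ∩ B).Nonempty ∧ (W ∩ (A \ B)).Nonempty) with h𝒲
  set H : Finset (Fin n) → Set (BondConfig (Fin n)) := fun W =>
    Du ∩ ({ω | ∀ x ∈ W, ∀ y ∈ A \ W, ω ∉ openConn x y} ∩ {ω | ∀ x ∈ W, ∀ y ∈ W, ω ∈ openConn x y})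
    with hH
  set G : Finset (Fin n) → Set (BondConfig (Fin n)) := fun W =>
    H W ∩ {ω | ∃ x ∈ W, ω ∈ openConn o x} with hG
  have hWmem : ∀ W ∈ 𝒲, W ⊆ A.erase u ∧ (W ∩ B).Nonempty ∧ (W ∩ (A \ B)).Nonempty := by
    intro W hW
    rw [h𝒲, Finset.mem_filter, Finset.mem_powerset] at hW
    exact ⟨hW.1, hW.2.1, hW.2.2⟩
  -- Step 1: the events `G W` are disjoint and lie in `{u ↮ far u} ∩ Λᶜ`
  have hGsub : ∀ W ∈ 𝒲, G W ⊆ {ω | ∀ b ∈ far u, ω ∉ openConn u b} ∩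
      {ω | A.filter (fun a => ω ∈ openConn o a) = B ∨
        A.filter (fun a => ω ∈ openConn o a) = A \ B ∨
        ∃ r ∈ L, A.filter (fun a => ω ∈ openConn o a) = {r}}ᶜ := by
    intro W hW ω hω
    obtain ⟨hWu, ⟨x₁, hx₁⟩, ⟨x₂, hx₂⟩⟩ := hWmem W hW
    have hWA : W ⊆ A := hWu.trans (Finset.erase_subset u A)
    obtain ⟨⟨hD, hI, hC⟩, ⟨x, hxW, hox⟩⟩ := hω
    have hreach : ∀ y ∈ W, y ∈ A.filter (fun a => ω ∈ openConn o a) := fun y hy =>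
      Finset.mem_filter.2 ⟨hWA hy, (hox : (openGraph ω).Reachable o x).trans (hC x hxW y hy)⟩
    have hx₁F := hreach x₁ (Finset.mem_inter.1 hx₁).1
    have hx₂F := hreach x₂ (Finset.mem_inter.1 hx₂).1
    have hx₁B : x₁ ∈ B := (Finset.mem_inter.1 hx₁).2
    have hx₂B : x₂ ∉ B := (Finset.mem_sdiff.1 (Finset.mem_inter.1 hx₂).2).2
    refine ⟨fun b hb => hD b (hfaru hb), ?_⟩
    rintro (hF | hF | ⟨r, -, hF⟩)
    · rw [hF] at hx₂F; exact hx₂B hx₂F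
    · rw [hF] at hx₁F; exact (Finset.mem_sdiff.1 hx₁F).2 hx₁B
    · rw [hF, Finset.mem_singleton] at hx₁F hx₂F
      rw [hx₁F, ← hx₂F] at hx₁B; exact hx₂B hx₁B
  have hGdisj : (↑𝒲 : Set (Finset (Fin n))).PairwiseDisjoint G := by
    intro W hW W' hW' hne
    simp only [Function.onFun]
    refine Set.disjoint_left.2 fun ω hω hω' => hne ?_
    obtain ⟨⟨-, hI, hC⟩, ⟨x, hxW, hox⟩⟩ := hω
    obtain ⟨⟨-, hI', hC'⟩, ⟨x', hxW', hox'⟩⟩ := hω'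
    exact class_unique A W W' ((hWmem W (Finset.mem_coe.1 hW)).1.trans (Finset.erase_subset u A))
      ((hWmem W' (Finset.mem_coe.1 hW')).1.trans (Finset.erase_subset u A)) ω hI hC hI' hC' hxW hxW'
      ((SimpleGraph.Reachable.symm hox).trans hox')
  have step1 : ∑ W ∈ 𝒲, μ.real (G W) ≤ μ.real ({ω | ∀ b ∈ far u, ω ∉ openConn u b} ∩
      {ω | A.filter (fun a => ω ∈ openConn o a) = B ∨
        A.filter (fun a => ω ∈ openConn o a) = A \ B ∨
        ∃ r ∈ L, A.filter (fun a => ω ∈ openConn o a) = {r}}ᶜ) := by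
    rw [← measureReal_biUnion_finset hGdisj (fun W _ => MeasurableSet.of_discrete)]
    exact measureReal_mono (Set.iUnion₂_subset fun W hW => hGsub W hW) (measure_ne_top _ _)
  -- Step 2: each realised crossing block gains at rate `Σ_{r ∈ L ∩ W} φ_r`
  have step2 : ∀ W ∈ 𝒲, (∑ r ∈ L ∩ W, φ r) * μ.real (H W) ≤ μ.real (G W) :=
    fun W hW => gain_class w A W L o u (hWmem W hW).1 huA hpos
  -- Step 3: `{u ↮ A∖u} ∩ {r ↔ far r}` lies in the union of the `H W` over crossing blocks `W ∋ r`
  have step3 : ∀ r ∈ L.erase u, μ.real (Du ∩ {ω | ∃ b ∈ far r, ω ∈ openConn r b}) ≤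
      ∑ W ∈ 𝒲.filter (fun W => r ∈ W), μ.real (H W) := by
    intro r hr
    obtain ⟨hru, hrL⟩ := Finset.mem_erase.1 hr
    obtain ⟨hrA, _, hfarrb⟩ := far_facts_gain A B L far hBA hL hrL
    have hdisj : (↑(𝒲.filter (fun W => r ∈ W)) : Set (Finset (Fin n))).PairwiseDisjoint H := by
      intro W hW W' hW' hne
      simp only [Function.onFun]
      have hW1 := Finset.mem_filter.1 (Finset.mem_coe.1 hW)
      have hW2 := Finset.mem_filter.1 (Finset.mem_coe.1 hW')
      refine Set.disjoint_left.2 fun ω hω hω' => hne ?_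
      obtain ⟨-, hI, hC⟩ := hω
      obtain ⟨-, hI', hC'⟩ := hω'
      exact class_unique A W W' ((hWmem W hW1.1).1.trans (Finset.erase_subset u A))
        ((hWmem W' hW2.1).1.trans (Finset.erase_subset u A)) ω hI hC hI' hC' hW1.2 hW2.2
        (SimpleGraph.Reachable.refl r)
    rw [← measureReal_biUnion_finset hdisj (fun W _ => MeasurableSet.of_discrete)]
    refine measureReal_mono ?_ (measure_ne_top _ _)
    rintro ω ⟨hD, ⟨b, hb, hrb⟩⟩
    have hrb' : (openGraph ω).Reachable r b := hrb
    -- the realised block of `r`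
    set W : Finset (Fin n) := (A.erase u).filter (fun x => ω ∈ openConn r x) with hWdef
    have hbu : b ≠ u := by
      rintro rfl
      exact hD r (Finset.mem_erase.2 ⟨hru, hrA⟩) hrb'.symm
    have hrW : r ∈ W := Finset.mem_filter.2 ⟨Finset.mem_erase.2 ⟨hru, hrA⟩,
      (SimpleGraph.Reachable.refl r : (openGraph ω).Reachable r r)⟩
    have hbA : b ∈ A := by
      rcases hfarrb b hb with ⟨-, hbB⟩ | ⟨-, hbB⟩
      · exact (Finset.mem_sdiff.1 hbB).1
      · exact hBA hbB
    have hbW : b ∈ W := Finset.mem_filter.2 ⟨Finset.mem_erase.2 ⟨hbu, hbA⟩, hrb⟩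
    have hW𝒲 : W ∈ 𝒲 := by
      rw [h𝒲, Finset.mem_filter, Finset.mem_powerset]
      refine ⟨Finset.filter_subset _ _, ?_⟩
      rcases hfarrb b hb with ⟨hrB, hbB⟩ | ⟨hrB, hbB⟩
      · exact ⟨⟨r, Finset.mem_inter.2 ⟨hrW, hrB⟩⟩, ⟨b, Finset.mem_inter.2 ⟨hbW, hbB⟩⟩⟩
      · exact ⟨⟨b, Finset.mem_inter.2 ⟨hbW, hbB⟩⟩, ⟨r, Finset.mem_inter.2 ⟨hrW, hrB⟩⟩⟩
    have hωH : ω ∈ H W := by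
      refine ⟨hD, fun x hx y hy hxy => ?_, fun x hx y hy => ?_⟩
      · have hrx : (openGraph ω).Reachable r x := (Finset.mem_filter.1 hx).2
        have hry : (openGraph ω).Reachable r y := hrx.trans hxy
        obtain ⟨hyA, hyW⟩ := Finset.mem_sdiff.1 hy
        by_cases hyu : y = u
        · subst hyu
          exact hD r (Finset.mem_erase.2 ⟨hru, hrA⟩) hry.symm
        · exact hyW (Finset.mem_filter.2 ⟨Finset.mem_erase.2 ⟨hyu, hyA⟩, hry⟩)
      · have hrx : (openGraph ω).Reachable r x := (Finset.mem_filter.1 hx).2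
        have hry : (openGraph ω).Reachable r y := (Finset.mem_filter.1 hy).2
        exact hrx.symm.trans hry
    exact Set.mem_iUnion₂.2 ⟨W, Finset.mem_coe.2 (Finset.mem_filter.2 ⟨hW𝒲, hrW⟩), hωH⟩
  -- Step 4: exchange the sums
  have hLW : ∀ W ∈ 𝒲, (L.erase u).filter (fun r => r ∈ W) = L ∩ W := by
    intro W hW
    ext r
    simp only [Finset.mem_filter, Finset.mem_erase, Finset.mem_inter]
    constructor
    · rintro ⟨⟨-, hrL⟩, hrW⟩; exact ⟨hrL, hrW⟩
    · rintro ⟨hrL, hrW⟩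
      exact ⟨⟨fun h => Finset.ne_of_mem_erase ((hWmem W hW).1 hrW) h, hrL⟩, hrW⟩
  have step4 : ∑ r ∈ L.erase u, φ r * ∑ W ∈ 𝒲.filter (fun W => r ∈ W), μ.real (H W) =
      ∑ W ∈ 𝒲, (∑ r ∈ L ∩ W, φ r) * μ.real (H W) := by
    calc ∑ r ∈ L.erase u, φ r * ∑ W ∈ 𝒲.filter (fun W => r ∈ W), μ.real (H W)
        = ∑ r ∈ L.erase u, ∑ W ∈ 𝒲, (if r ∈ W then φ r * μ.real (H W) else 0) := by
          refine Finset.sum_congr rfl fun r _ => ?_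
          rw [Finset.mul_sum, Finset.sum_filter]
      _ = ∑ W ∈ 𝒲, ∑ r ∈ L.erase u, (if r ∈ W then φ r * μ.real (H W) else 0) := Finset.sum_comm
      _ = ∑ W ∈ 𝒲, (∑ r ∈ L ∩ W, φ r) * μ.real (H W) := by
          refine Finset.sum_congr rfl fun W hW => ?_
          rw [← Finset.sum_filter, hLW W hW, Finset.sum_mul]
  calc ∑ r ∈ L.erase u, φ r * μ.real (Du ∩ {ω | ∃ b ∈ far r, ω ∈ openConn r b})
      ≤ ∑ r ∈ L.erase u, φ r * ∑ W ∈ 𝒲.filter (fun W => r ∈ W), μ.real (H W) :=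
        Finset.sum_le_sum fun r hr => mul_le_mul_of_nonneg_left (step3 r hr) (hφ0 r)
    _ = ∑ W ∈ 𝒲, (∑ r ∈ L ∩ W, φ r) * μ.real (H W) := step4
    _ ≤ ∑ W ∈ 𝒲, μ.real (G W) := Finset.sum_le_sum step2
    _ ≤ _ := step1

end TwoLevelLonelyRelay

end Summit.CriticalPhenomena.PercolationContinuityZ3.Theorems
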